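import Summits.AtomisticToContinuum.HydrodynamicLimit.Theses.InformationPercolationEngine
import Summits.AtomisticToContinuum.HydrodynamicLimit.Theorems.InformationPercolationEnginePercolationClosesChaosForecastRobustDefs

/-!
# Line `short-step-conditional-forecast` for crux `InformationPercolationEngine.PercolationClosesChaos` — skeleton v1
(item stmt-AtomisticToContinuum-15178, rev 12: `KickFairRelEquilibriumMeso → SpectralContractionR → ContactChaos`;
crux-strategist seat `cstrat-stmt-AtomisticToContinuum-15178-p1`, 2026-08-17; line card `Lines/short-step-conditional-forecast.md`)

## What this line is

The SHORT-STEP SUCCESSOR of the saturated line `equilibrium-forecast-chain-rule` (dead note `Lines/equilibrium-forecast-chain-rule-dead.md`,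
lead report c3 §7, dead note §4 (c)): the same KL chain-rule / predictable-projection engine along a nested mesoscopic filtration of the
deterministic flow, but with TWO scales — kinetic cells of side `h = c ℓ_N` (`c → ∞` cells of many mean free paths, `n̄ = c³/(π³σ⁶) → ∞`
spheres) and SHORT steps `Δ' = ℓ_N / m` (`m` steps per mean free time, `m` FIXED — the `G_N`-side prover's choice, default `m = 10`;
`σ₁(m)³ < 1/(π m)` keeps dead-reckoning from the revealed itineraries coarser than a diameter) — and with the crux-class input re-cut from an EVERY-RATE
large-deviation statement about the invariant law (`MesoForecastChaosB`, the stub on which five leads saturated: the `N`-body LD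
H-theorem, unapproachable) back to an ATOMWISE one-step conditional statement on GENERIC revealed atoms:

* `ConditionalForecastChaosS` (S1, crux-class, THE stub): under the invariant law `G_N`, conditionally on any atom of the short-step
  sequential history whose REVEALED data are binned-good (regular, near-Maxwellian) and GENERIC (occupancies of the `4h`-neighbourhood in a
  window `[ϱlo n̄, ϱhi n̄]`, cell kinetic energies `≤ E₀ n̄`, at most `R₀ n̄/m` collision records in the neighbourhood during the step just
  ended — every one a function of the atom), the forecast of the truncated collision-defect weight of the unit over the NEXT short step is
  `≤ δ`. A short-time (`1/m` mean free times) CONDITIONAL-LANFORD / conditional-equidistribution statement for the explicit measure `G_N`,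
  `N`-uniform at the kinetic scale; it dodges the v1 atom kills (density-dip / void atoms: occupancy floor; Newton's-cradle cascades:
  record cap; converging free flights and in-step drift of the reference pair law: short steps) and needs NO large deviations.
* `NonGenericRareS` (S2, item-class): under the EVOLVED law the collision-weighted mass of occupied non-generic units is small — an
  a-priori statement of the `DensityCap` / `NoKineticIrregularity` / `LocalCountUI` class (upper AND lower occupancy, energy, counts).

With these two, the LG-side hypothesis H2 of the transfer architecture (`BadForecastRareB`: binned-good units with a bad `G_N`-forecast are
LG-rare) follows WITHOUT the entropy inequality: the event `{good ∧ generic ∧ forecast > δ}` is `G_N`-NULL by S1, hence `LG`-null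
(`LG ≪ G_N`, finite budget), and the non-generic remainder rides the collision-WEIGHTED channel of `ForecastSplitW` (indicator
`J' = Jng ∨ ¬Generic`, revealed) into S2. The entropy budget `H(LG | G_N) ≤ A(N+1)` is spent ONLY linearly, in H1 (predictable projection,
PROVED: `predictableProjection_holds`), whose remainder `T h³ √(2 M A (N+1)/K)` improves with the larger step count `K = m τ/ℓ_N`.

The other stubs are the short-step twins of the saturated line's item-class inputs (S3 kinetic clamp = `LocalCountUIS ∧ NoKineticIrregularityBS ∧
RevealedDefectStabilityS`; S4 `CoarseLocalMaxwellianityWS`; S5 `NoMesoscopicOscillationRS` = route kill criterion (iv)) and the two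
RE-LANDINGS of its proved architecture at the scale pair `(cℓ_N, ℓ_N/m)` (S6 transfer = H1–H5_W of `kineticCellChaosLG_of_w`; S7 docking =
`stub_dockingR`), theorem-class (done once, p157027 / p143824; the proofs are scale-agnostic in structure: docking budget `(Δ' + h)/r⁴ → 0`,
displacement `Δ'·speed`, enumeration any `Δ'`).

## Disproof used
`Cruxes/PercolationClosesChaos/Disproof.lean` §1/F16: the crux is `KMeso → ContactChaos` with `SpectralContractionR` PROVED and decorative and
no `_false_without_` theorem possible; this line concludes through `ContactChaos` (the dock `crux_of_contactChaos`) and uses neither hypothesis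
(dead note §4 (a): `KMeso` governs only the impact-vector law given a past that pins `(v, v*)`). F8 D1–D5 not used (no kick σ-algebra, no
spectral input, no sector split, no synchronisation). F18 (d): the collision weighting is TRUNCATED (`min(ownedCountS, T)`) and the count tail is
the named stub S3 (i); F18 (e) / `docking_reference_gap` p108600: the docking meets the target's own `targetPm` (S5 is typed against it).
F20/F21: no exponential (speed-`N`) transfer anywhere in the line. Landed Negative lemmas (`KeepSwapFamily`, `CollisionSphereKinematics`,
`OutgoingDirectionShadow`, `SketchLineTypedAudit`, `WindowTransferTailGap`, `SubcellColocationExcess`, `WindowBurden`, `DockingReferenceGap`,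
`NecklaceFloor`): no stub is an instance any of them refutes (they concern kick fairness, spectral docks, snapshot placement, DV floors).

## Stubs (7) and composition
S1 `stub_conditionalForecastChaos` (crux-class) · S2 `stub_nonGenericRare` · S3 `stub_kineticClamp` · S4 `stub_coarseLocalMaxwellianity` ·
S5 `stub_noMesoscopicOscillation` · S6 `stub_shortStepTransfer` · S7 `stub_shortStepDocking`; `PercolationClosesChaos_of_stubs : S1 → … → S7 → crux`
and `PercolationClosesChaos_of : crux`, kernel-checked, sorries only inside `stub_*`.
-/

noncomputable section

open MeasureTheory Set Filter Topology
open scoped ENNReal BigOperators Classical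
open Literature.Analysis.FluidPDE Literature.MathematicalPhysics.KineticTheory
open Literature.MathematicalPhysics.KineticTheory.VelocityBlindPlacement
open Summit.AtomisticToContinuum.HydrodynamicLimit.Theses.InformationPercolationEngine
open Summit.AtomisticToContinuum.HydrodynamicLimit.Theorems.EquilibriumForecastLine

namespace Summit.AtomisticToContinuum.HydrodynamicLimit.Cruxes.PercolationClosesChaos.ShortStepConditionalForecast

/-! ## §1 The second time scale: short steps `Δ' = ℓ_N / m` (cells keep side `c ℓ_N`; `cellOf`, `cellCount`, `pop`, `nbhd`, `kde`,
`relEnt`, `inhom`, `Dense`, `Regular`, `GoodUnit(B)`, `binConfig`, `fluxAvg`, `markOf`, `targetPm`, `eqLaw` are the tree's, unchanged) -/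

/-- SHORT STEP duration `Δ'_N = ℓ_N / m` (thermal speed `1`: `1/m` mean free times). -/
def stepLenS (m : ℕ) (σ : ℝ) (N : ℕ) : ℝ := meanFreePath σ N / (m : ℝ)

/-- Start time `k Δ'` of short step `k`. -/
def stepStartS (m : ℕ) (σ : ℝ) (N : ℕ) (k : ℕ) : ℝ := (k : ℝ) * stepLenS m σ N

/-- Time window `(kΔ', (k+1)Δ']` of short step `k`. -/
def stepWindowS (m : ℕ) (σ : ℝ) (N : ℕ) (k : ℕ) : Set ℝ :=
  Set.Ioc (stepStartS m σ N k) (stepStartS m σ N (k + 1))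

/-- Collision normalisation of a unit: `n̄ / m` (`≍ n̄` spheres × `≍ 1/m` collisions per sphere per short step). -/
def collNormS (c : ℝ) (m : ℕ) (σ : ℝ) (N : ℕ) : ℝ := cellCount c σ N / (m : ℝ)

/-- START CELL of sphere `i` for short step `k`: its kinetic cell at time `kΔ'`. -/
def startCellS (c : ℝ) (m : ℕ) (σ : ℝ) (N : ℕ) (Φ : Flow σ N) (k : ℕ) (z : Phase N) (i : Fin (N + 1)) : Cell :=
  cellOf c σ N ((Φ.flow (stepStartS m σ N k) z) i).1

/-- CELL-PAIR COLLISION STATISTIC of short step `k` (the tree's `collPair` with window `stepWindowS` and normalisation `n̄/m`). -/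
def collPairS (Ψ : V3 × V3 × V3 → ℝ) (c : ℝ) (m : ℕ) (σ : ℝ) (N : ℕ) (Φ : Flow σ N) (k : ℕ) (q q' : Cell)
    (z : Phase N) : ℝ :=
  (collNormS c m σ N)⁻¹ *
    Φ.collisionPairSum (stepWindowS m σ N k)
      (fun _ w i j =>
        if startCellS c m σ N Φ k z i = q ∧ startCellS c m σ N Φ k z j = q' then Ψ (markOf N (hsDiameter σ N) w i j)
        else 0) z

/-- CELL-PAIR PAIR-LAW STATISTIC at the start of short step `k` (the tree's `pairPair` read at time `kΔ'`): flux-weighted product of the two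
start-cell populations' OWN velocity laws tested against `Ξ`. Over a SHORT step the population law moves by `O(1/m)`, so the
self-referential reference is quasi-stationary — the in-step drift that made the long-step atomwise statement false (W5 density bump,
adiabatic cooling; c3 §7) is `O(1/m)` here. -/
def pairPairS (Ξ : V3 × V3 × V3 → ℝ) (c : ℝ) (m : ℕ) (σ : ℝ) (N : ℕ) (Φ : Flow σ N) (k : ℕ) (q q' : Cell)
    (z : Phase N) : ℝ :=
  (cellCount c σ N ^ 2)⁻¹ *
    ∑ i : Fin (N + 1), ∑ j : Fin (N + 1),
      (if i ≠ j ∧ startCellS c m σ N Φ k z i = q ∧ startCellS c m σ N Φ k z j = q' then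
          fluxAvg Ξ ((Φ.flow (stepStartS m σ N k) z) i).2 ((Φ.flow (stepStartS m σ N k) z) j).2
        else 0)

/-- RELATIVE CELL-PAIR DEFECT of short step `k` (rate-free, self-referential; junk when there is no `(q,q')`-collision, weightless below). -/
def relDefectS (Ψ : V3 × V3 × V3 → ℝ) (c : ℝ) (m : ℕ) (σ : ℝ) (N : ℕ) (Φ : Flow σ N) (k : ℕ) (q q' : Cell)
    (z : Phase N) : ℝ :=
  collPairS Ψ c m σ N Φ k q q' z / collPairS (fun _ => 1) c m σ N Φ k q q' z -
    pairPairS Ψ c m σ N Φ k q q' z / pairPairS (fun _ => 1) c m σ N Φ k q q' z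

/-- OWNED COLLISION COUNT of unit `(k, q)` (ordered contact pairs of the short step whose lex-min start cell is `q`), normalised by `n̄/m`. -/
def ownedCountS (c : ℝ) (m : ℕ) (σ : ℝ) (N : ℕ) (Φ : Flow σ N) (k : ℕ) (q : Cell) (z : Phase N) : ℝ :=
  (collNormS c m σ N)⁻¹ *
    Φ.collisionPairSum (stepWindowS m σ N k)
      (fun _ _ i j => if cellMin (startCellS c m σ N Φ k z i) (startCellS c m σ N Φ k z j) = q then (1 : ℝ) else 0) z

/-- ROW COLLISION COUNT of unit `(k, q)` (ordered contact pairs whose first member starts the short step in `q`), normalised by `n̄/m`. -/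
def rowCountS (c : ℝ) (m : ℕ) (σ : ℝ) (N : ℕ) (Φ : Flow σ N) (k : ℕ) (q : Cell) (z : Phase N) : ℝ :=
  (collNormS c m σ N)⁻¹ *
    Φ.collisionPairSum (stepWindowS m σ N k)
      (fun _ _ i _ => if startCellS c m σ N Φ k z i = q then (1 : ℝ) else 0) z

/-- DEFECT OF THE OWNED UNIT `(k, q)`: collision-weighted mean of `|relDefectS Ψ|` over the ordered cell pairs it owns. -/
def unitDefectS (Ψ : V3 × V3 × V3 → ℝ) (c : ℝ) (m : ℕ) (σ : ℝ) (N : ℕ) (Φ : Flow σ N) (k : ℕ) (q : Cell)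
    (z : Phase N) : ℝ :=
  (ownedCountS c m σ N Φ k q z)⁻¹ *
    ∑' q' : Cell,
      if q' = q then collPairS (fun _ => 1) c m σ N Φ k q q z * |relDefectS Ψ c m σ N Φ k q q z|
      else if q = cellMin q q' then
        collPairS (fun _ => 1) c m σ N Φ k q q' z * |relDefectS Ψ c m σ N Φ k q q' z| +
          collPairS (fun _ => 1) c m σ N Φ k q' q z * |relDefectS Ψ c m σ N Φ k q' q z|
      else 0

/-- The INCREMENT: truncated collision weight of the owned unit times the indicator that its defect exceeds `η` (`∈ [0, T]`). -/
def badWeightS (Ψ : V3 × V3 × V3 → ℝ) (η T c : ℝ) (m : ℕ) (σ : ℝ) (N : ℕ) (Φ : Flow σ N) (k : ℕ) (q : Cell)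
    (z : Phase N) : ℝ :=
  min (ownedCountS c m σ N Φ k q z) T * (if η < unitDefectS Ψ c m σ N Φ k q z then 1 else 0)

/-- Number of complete short steps in `[0, τ]`: `K = ⌊τ m / ℓ_N⌋ ≍ m τ (N+1)^{1/3} → ∞`. -/
def numStepsS (m : ℕ) (σ : ℝ) (N : ℕ) (τ : ℝ) : ℕ := ⌊τ / stepLenS m σ N⌋₊

/-- UNIT AVERAGE over (short step, cell): `K⁻¹ (cℓ_N)³ Σ_{k < K} Σ_q F k q`. -/
def unitAvgS (c : ℝ) (m : ℕ) (σ : ℝ) (N : ℕ) (τ : ℝ) (F : ℕ → Cell → ℝ) : ℝ :=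
  ((numStepsS m σ N τ : ℝ))⁻¹ * (c * meanFreePath σ N) ^ 3 *
    ∑ k ∈ Finset.range (numStepsS m σ N τ), ∑' q : Cell, F k q

/-- MEAN OF A UNIT AVERAGE under a law `μ` on phase space. -/
def unitMeanS (c : ℝ) (m : ℕ) (σ : ℝ) (N : ℕ) (τ : ℝ) (μ : Measure (Phase N)) (F : ℕ → Cell → Phase N → ℝ) : ℝ :=
  ∫ z, unitAvgS c m σ N τ (fun k q => F k q z) ∂μ

/-! ## §2 The short-step mesoscopic filtration (countable alphabet; no collision times recorded) -/

/-- ORDERED LIST OF REDUCED COLLISION RECORDS of sphere `i` with times in `((k−1)Δ', kΔ']` (empty for `k = 0`): (partner label, own binned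
pre-velocity, own binned post-velocity, partner's binned pre-velocity) — the tree's `jumps` at step length `Δ'`. -/
def jumpsS (b : ℝ) (m : ℕ) (σ : ℝ) (N : ℕ) (Φ : Flow σ N) (k : ℕ) (i : Fin (N + 1)) (z : Phase N) :
    List (Fin (N + 1) × Cell × Cell × Cell) :=
  let Δ := stepLenS m σ N
  let cnt := Set.ncard (collisionTimesOf G3 (hsDiameter σ N) (fun t => Φ.flow t z) i ∩ Set.Ioc 0 ((k : ℝ) * Δ))
  ((List.range cnt).filter fun n => decide (((k : ℝ) - 1) * Δ < Φ.nthCollisionTimeOf i n z)).map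
    fun n => (Φ.nthPartnerOf i n z, velBin b (Φ.nthRecordOf i n z).preVel.1, velBin b (Φ.nthRecordOf i n z).postVel.1,
      velBin b (Φ.nthRecordOf i n z).preVel.2)

/-- OBSERVATION AT TIME `kΔ'` of all spheres (cut to the good set): (cell, velocity bin) now, reduced records of the step just ended. -/
def obsS (b c : ℝ) (m : ℕ) (σ : ℝ) (N : ℕ) (Φ : Flow σ N) (k : ℕ) (z : Phase N) : Fin (N + 1) → Obs N := fun i =>
  if z ∈ Φ.good then
    ((cellOf c σ N ((Φ.flow (stepStartS m σ N k) z) i).1, velBin b ((Φ.flow (stepStartS m σ N k) z) i).2),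
      jumpsS b m σ N Φ k i z)
  else ((0, 0), [])

/-- SHORT-STEP HISTORY up to time `kΔ'`. -/
def histS (b c : ℝ) (m : ℕ) (σ : ℝ) (N : ℕ) (Φ : Flow σ N) (k : ℕ) (z : Phase N) : Fin (k + 1) → Fin (N + 1) → Obs N :=
  fun j => obsS b c m σ N Φ j z

/-- SEQUENTIAL HISTORY for the owned unit `(k, q)`: the past up to `kΔ'` together with the step-`k` observations (at `(k+1)Δ'`) of the
spheres whose start cell is lexicographically smaller than `q` (already revealed when `q` is forecast). The engine's `𝓕_{k,q}` is
`MeasurableSpace.comap (seqHistS …) ⊤`. -/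
def seqHistS (b c : ℝ) (m : ℕ) (σ : ℝ) (N : ℕ) (Φ : Flow σ N) (k : ℕ) (q : Cell) (z : Phase N) :
    (Fin (k + 1) → Fin (N + 1) → Obs N) × (Fin (N + 1) → Option (Obs N)) :=
  (histS b c m σ N Φ k z,
    fun i => if cellLT (obsS b c m σ N Φ k z i).1.1 q then some (obsS b c m σ N Φ (k + 1) z i) else none)

/-- The data REVEALED RIGHT AFTER unit `(k, q)` in the start-cell order (the engine's `𝓕_{n(k,q)+1}`). -/
def seqHistLES (b c : ℝ) (m : ℕ) (σ : ℝ) (N : ℕ) (Φ : Flow σ N) (k : ℕ) (q : Cell) (z : Phase N) :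
    (Fin (k + 1) → Fin (N + 1) → Obs N) × (Fin (N + 1) → Option (Obs N)) :=
  (histS b c m σ N Φ k z,
    fun i => if cellLT q (obsS b c m σ N Φ k z i).1.1 then none else some (obsS b c m σ N Φ (k + 1) z i))

/-- OSCILLATION OF THE UNIT DEFECT over the revealed-data atom of `z` (grazing kicks below the bin width, velocity tails, binning). -/
def defectOscS (Ψ : V3 × V3 × V3 → ℝ) (b c : ℝ) (m : ℕ) (σ : ℝ) (N : ℕ) (Φ : Flow σ N) (k : ℕ) (q : Cell)
    (z : Phase N) : ℝ :=
  sSup ((fun z' => |unitDefectS Ψ c m σ N Φ k q z' - unitDefectS Ψ c m σ N Φ k q z|) ''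
    (Φ.good ∩ {z' | seqHistLES b c m σ N Φ k q z' = seqHistLES b c m σ N Φ k q z}))

/-- The `G_N`-FORECAST of a unit-indexed family along the short-step filtration: `(k, q) ↦ E_{G_N}[F k q | σ(seqHistS … k q)]`. -/
def gForecastS (b c : ℝ) (m : ℕ) (σ : ℝ) (N : ℕ) (Φ : Flow σ N) (F : ℕ → Cell → Phase N → ℝ) :
    ℕ → Cell → Phase N → ℝ :=
  fun k q => MeasureTheory.condExp (MeasurableSpace.comap (seqHistS b c m σ N Φ k q) ⊤) (eqLaw σ N Φ) (F k q)

/-! ## §3 GENERICITY, read from the revealed data (the v1 atom kills — density dip / void, Newton's cradle — are non-generic) -/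

/-- Number of reduced collision records of the step just ended (`((k−1)Δ', kΔ']`) carried by the spheres of the `4cℓ`-neighbourhood of `q`,
read from a sequential history (its `hist k` component at index `k`). -/
def recCountO (c σ : ℝ) (N : ℕ) {k : ℕ}
    (H : (Fin (k + 1) → Fin (N + 1) → Obs N) × (Fin (N + 1) → Option (Obs N))) (q : Cell) : ℕ :=
  ∑ i ∈ nbhdO c σ N (histData H) q, ((H.1 (Fin.last k) i).2).length

/-- Kinetic energy (binned velocities) of the population of cell `q'`, read from (cell, bin) data. -/
def cellEnergyO {N : ℕ} (b : ℝ) (o : Fin (N + 1) → Cell × Cell) (q' : Cell) : ℝ :=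
  ∑ i ∈ popO o q', ‖binCentre b (o i).2‖ ^ 2

/-- **GENERIC revealed data around `q`**: (i) every kinetic cell whose centre is within `4cℓ` of the centre of `q` holds between `ϱlo n̄` and
`ϱhi n̄` spheres (occupancy WINDOW — excludes the density-dip / void / rarefied and the over-crowded atoms) and (ii) has binned kinetic
energy `≤ E₀ n̄`; (iii) the spheres of the `4cℓ`-neighbourhood carry at most `R₀ · n̄/m` collision records from the step just ended (record
CAP — excludes certified collision cascades). All three are functions of the revealed (cell, bin, record) data. -/
def GenericO (ϱlo ϱhi E₀ R₀ b c : ℝ) (m : ℕ) (σ : ℝ) (N : ℕ) {k : ℕ}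
    (H : (Fin (k + 1) → Fin (N + 1) → Obs N) × (Fin (N + 1) → Option (Obs N))) (q : Cell) : Prop :=
  (∀ q' : Cell, Torus.euclidDist (cellCentre c σ N q') (cellCentre c σ N q) ≤ 4 * (c * meanFreePath σ N) →
      ϱlo * cellCount c σ N ≤ ((popO (histData H) q').card : ℝ) ∧
        ((popO (histData H) q').card : ℝ) ≤ ϱhi * cellCount c σ N ∧
        cellEnergyO b (histData H) q' ≤ E₀ * cellCount c σ N) ∧
    (recCountO c σ N H q : ℝ) ≤ R₀ * collNormS c m σ N

/-- **GENERIC UNIT** `(k, q)` along the flow: `GenericO` read on the sequential history `seqHistS … k q z` — a function of the atom BY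
CONSTRUCTION (hence `σ(seqHistS k q)`-measurable up to the good-set cut). -/
def GenericS (ϱlo ϱhi E₀ R₀ b c : ℝ) (m : ℕ) (σ : ℝ) (N : ℕ) (Φ : Flow σ N) (k : ℕ) (q : Cell) (z : Phase N) : Prop :=
  GenericO ϱlo ϱhi E₀ R₀ b c m σ N (seqHistS b c m σ N Φ k q z) q

/-- `GenericS` factors through the sequential history. [folklore] -/
theorem genericS_eq_of_seqHistS_eq {ϱlo ϱhi E₀ R₀ b c : ℝ} {m : ℕ} {σ : ℝ} {N : ℕ} {Φ : Flow σ N} {k : ℕ} {q : Cell}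
    {z z' : Phase N} (h : seqHistS b c m σ N Φ k q z = seqHistS b c m σ N Φ k q z') :
    GenericS ϱlo ϱhi E₀ R₀ b c m σ N Φ k q z ↔ GenericS ϱlo ϱhi E₀ R₀ b c m σ N Φ k q z' := by
  unfold GenericS; rw [h]

/-! ## §4 The typed statements -/

/-- **S1 `ConditionalForecastChaosS`** — ATOMWISE CONDITIONAL FORECAST CHAOS OF THE INVARIANT LAW ON GENERIC GOOD ATOMS OVER ONE SHORT
STEP (crux-class; the ONE open stub of the line). There are a step parameter `m ≥ 1` (the prover's choice, default `m = 10`: `1/m` mean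
free times is inside the short-time regime of Lanford1975 / GST2013), a packing threshold `φs > 0` and `σ₁ > 0` (with `π m σ₁³ < 1`: the
position resolution `v̄ ℓ_N/m` of the revealed cell itineraries stays COARSER than the diameter `ε_N = π σ³ ℓ_N`, so no atom pins an
individual impact parameter, whatever the bin width `b`) such that for `0 < σ ≤ σ₁`, every flow family, every bounded continuous mark test
`Ψ`, all `ϑs, η, δ, T > 0` and every genericity window `(ϱlo ≤ ϱhi, E₀, R₀)` there are a Maxwellian/homogeneity tolerance `ϑ > 0` and `c₀`
such that for `c ≥ c₀` there is `b₀ > 0` such that for `0 < b ≤ b₀` and all large `N`, for EVERY unit `(k, q)`, `G_N`-almost surely: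
if the unit is binned-GOOD at `kΔ'` and GENERIC then `E_{G_N}[badWeightS Ψ η T (k,q) | σ(seqHistS b c m σ N Φ k q)] ≤ δ`
— i.e. on every good generic atom of positive `G_N`-mass the conditional mean of the truncated bad-defect weight of the next short
step is `≤ δ` (guard and forecast are both functions of the atom).
CONTENT (lead c3 §7 (D), made explicit): `G_N` conditioned on a coarse dynamical atom is, at the DIAMETER scale `ε_N`, locally uniform
and decorrelated across recent-history clusters — fresh pairs of the next short step collide with probability `∝` flux × uniform impact
parameter (positions are anchored in space only to `≳ ℓ_N/m ≫ ε_N = πσ³ℓ_N` for `σ³ < 1/(π m)`), pinned (recent-ring) pairs number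
`O(φ n̄/m)` and enter the conditional mean at CLT scale `√(φ n̄/m) = o(n̄/m)` as `c → ∞`; chaos in conditional mean + concentration over
`≍ n̄/m → ∞` owned collisions ⇒ `P(unitDefectS > η | atom) → 0`. A short-time CONDITIONAL LANFORD / conditional-equidistribution
statement for an explicit reversible measure (Lanford1975, GST2013 regime: `1/m` mean free times, dilute; the conditional version —
uniformity over generic coarse atoms — is UNPRINTED; u-Gibbs / standard-pair heuristics doi:10.1090/surv/127 Ch. 5/7). The `O(φ·ϑ^{1/2})`
ring correction on `ϑ`-non-Maxwellian units (Choh–Uhlenbeck triple-collision class) is why the guard keeps `relEnt ≤ ϑ` with `ϑ = ϑ(η, σ₁)`.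
WHY IT MIGHT FAIL: a family of forecast-bad GENERIC good atoms (e.g. a coherent ring geometry certified by OLDER records than the last step,
or sub-bin velocity information accumulated along long collision-free itineraries) — then genericity must be strengthened (and S2 with it)
or the statement is false as the v1 form was; conditional equidistribution of `G_N` on thin dynamical atoms may need an `N`-uniform
growth lemma after all (TRIAGE-r2-1 doubt). CHEAPEST FALSIFIER: equilibrium event-driven MD (`N = 10⁴`, `φ ∈ {0.02, 0.05}`, `m = 10`,
`c ∈ {2, 4}`): residual of actual vs resampled-forecast one-step collision statistics binned by unused history summaries (ring flags,
itinerary length); an `N`-, `c`-stable residual on generic good units kills S1. -/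
def ConditionalForecastChaosS : Prop :=
  ∃ m : ℕ, 1 ≤ m ∧ ∃ φs : ℝ, 0 < φs ∧ ∃ σ₁ : ℝ, 0 < σ₁ ∧ ∀ σ : ℝ, 0 < σ → σ ≤ σ₁ → ∀ Φ : (N : ℕ) → Flow σ N,
  ∀ Ψ : V3 × V3 × V3 → ℝ, Continuous Ψ → (∃ C : ℝ, ∀ p, |Ψ p| ≤ C) →
  ∀ ϑs η δ T : ℝ, 0 < ϑs → 0 < η → 0 < δ → 0 < T →
  ∀ ϱlo ϱhi E₀ R₀ : ℝ, 0 < ϱlo → ϱlo ≤ ϱhi → 0 < E₀ → 0 < R₀ →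
  ∃ ϑ : ℝ, 0 < ϑ ∧ ∃ c₀ : ℝ, 0 < c₀ ∧ ∀ c : ℝ, c₀ ≤ c →
  ∃ b₀ : ℝ, 0 < b₀ ∧ ∀ b : ℝ, 0 < b → b ≤ b₀ → ∃ N₀ : ℕ, ∀ N : ℕ, N₀ ≤ N → ∀ k : ℕ, ∀ q : Cell,
    ∀ᵐ z ∂(eqLaw σ N (Φ N)),
      GoodUnitB b ϑs ϑ φs c σ N ((Φ N).flow (stepStartS m σ N k) z) q →
      GenericS ϱlo ϱhi E₀ R₀ b c m σ N (Φ N) k q z →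
        gForecastS b c m σ N (Φ N) (badWeightS Ψ η T c m σ N (Φ N)) k q z ≤ δ

/-- **S2 `NonGenericRareS`** — NON-GENERIC UNITS ARE RARE UNDER THE EVOLVED LAW, COLLISION-WEIGHTED (item-class LG-side a-priori input of
the `DensityCap` / `NoKineticIrregularity` / `LocalCountUI` class — lead c3 §7 (G)). For continuous positive profiles there is `σ₀ > 0`
such that for `0 < σ < σ₀`, every flow family, `τ > 0` and `δ, T > 0` there is a genericity window `(ϱlo ≤ ϱhi, E₀, R₀)` (depending on
the profiles: `ϱlo < ½ inf a₀`, `ϱhi > 2 sup a₀`, …) such that for every `m ≥ 1` there is `c₀` with: for `c ≥ c₀` there is `b₀` such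
that for `0 < b ≤ b₀` and all large `N` the `LG`-mean of the unit average of `𝟙{occupied at kΔ' ∧ ¬Generic (k,q)} · min(ownedCountS, T)`
is `≤ δ`. At time `0` provable (Gibbs concentration of occupancies / energies / one-step counts at `n̄ → ∞`); at positive times it is
propagation of "no cavitation, no over-crowding, no over-heating, no over-colliding kinetic neighbourhoods" for the evolved law, global
in `τ` (implosion / cavitation caveat of Disproof F10 (e) applies verbatim, as to the target). -/
def NonGenericRareS : Prop :=
  ∀ (a₀ θ₀ : T3 → ℝ) (u₀ : T3 → V3), Continuous a₀ → Continuous θ₀ → Continuous u₀ →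
    (∀ x, 0 < a₀ x) → (∀ x, 0 < θ₀ x) →
  ∃ σ₀ : ℝ, 0 < σ₀ ∧ ∀ σ : ℝ, 0 < σ → σ < σ₀ → ∀ Φ : (N : ℕ) → Flow σ N, ∀ τ : ℝ, 0 < τ →
  ∀ δ T : ℝ, 0 < δ → 0 < T →
  ∃ ϱlo ϱhi E₀ R₀ : ℝ, 0 < ϱlo ∧ ϱlo ≤ ϱhi ∧ 0 < E₀ ∧ 0 < R₀ ∧
  ∀ m : ℕ, 1 ≤ m → ∃ c₀ : ℝ, 0 < c₀ ∧ ∀ c : ℝ, c₀ ≤ c → ∃ b₀ : ℝ, 0 < b₀ ∧ ∀ b : ℝ, 0 < b → b ≤ b₀ →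
  ∃ N₀ : ℕ, ∀ N : ℕ, N₀ ≤ N →
    unitMeanS c m σ N τ (localGibbsLaw σ a₀ u₀ θ₀ N (Φ N)) (fun k q z =>
      (if (pop c σ N ((Φ N).flow (stepStartS m σ N k) z) q).Nonempty ∧
          ¬ GenericS ϱlo ϱhi E₀ R₀ b c m σ N (Φ N) k q z then (1 : ℝ) else 0) *
        min (ownedCountS c m σ N (Φ N) k q z) T) ≤ δ

/-- **`KineticCellChaosLGS`** — KINETIC-CELL CHAOS UNDER LOCAL GIBBS DATA at the scale pair `(cℓ_N, ℓ_N/m)` (the output of the transfer S6,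
docked by S7): there is a step parameter `m ≥ 1` (S1's) such that for continuous positive profiles there is `σ₀ > 0` such that for
`0 < σ < σ₀`, every flow family, `τ > 0`, bounded continuous `Ψ` and `η, δ, T > 0` there is `c₀` with: for `c ≥ c₀` and all large `N`, the
`LG`-expectation of the unit average of `badWeightS Ψ η T` is at most `δ` (the in-step drift of the self-referential reference on GOOD units is
`O(ϑ^{1/2} + ϑ)` per mean free time — near-Maxwellian population, homogeneous neighbourhood reaching `4cℓ ≫ v̄ ℓ/m` — so no `m → ∞` is needed). -/
def KineticCellChaosLGS : Prop :=
  ∃ m : ℕ, 1 ≤ m ∧ ∀ (a₀ θ₀ : T3 → ℝ) (u₀ : T3 → V3), Continuous a₀ → Continuous θ₀ → Continuous u₀ →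
    (∀ x, 0 < a₀ x) → (∀ x, 0 < θ₀ x) →
  ∃ σ₀ : ℝ, 0 < σ₀ ∧ ∀ σ : ℝ, 0 < σ → σ < σ₀ → ∀ Φ : (N : ℕ) → Flow σ N, ∀ τ : ℝ, 0 < τ →
  ∀ Ψ : V3 × V3 × V3 → ℝ, Continuous Ψ → (∃ C : ℝ, ∀ p, |Ψ p| ≤ C) →
  ∀ η δ T : ℝ, 0 < η → 0 < δ → 0 < T →
  ∃ c₀ : ℝ, 0 < c₀ ∧ ∀ c : ℝ, c₀ ≤ c → ∃ N₀ : ℕ, ∀ N : ℕ, N₀ ≤ N →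
    ∫⁻ z, ENNReal.ofReal (unitAvgS c m σ N τ fun k q => badWeightS Ψ η T c m σ N (Φ N) k q z)
      ∂(localGibbsLaw σ a₀ u₀ θ₀ N (Φ N)) ≤ ENNReal.ofReal δ

/-- **`LocalCountUIS`** — LOCAL UNIFORM INTEGRABILITY OF SHORT-STEP ROW COLLISION COUNTS AND A PACKING CAP UNDER THE EVOLVED LAW (the
tree's `LocalCountUI` at step `ℓ_N/m`; item-class): (i) there is a level `T` such that for every `m ≥ 1` there is `c₀` (normalisation
`n̄/m → ∞`) with: for `c ≥ c₀` and all large `N` the unit average of `rowCountS · 𝟙{rowCountS > T}` has `LG`-expectation `≤ δ`; (ii) for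
every `m ≥ 1` there is `c₀` such that for `c ≥ c₀` and all large `N` the unit-fraction of occupied cells with a `φs`-PACKED
`4cℓ`-neighbourhood at the step start has `LG`-expectation `≤ δ`. -/
def LocalCountUIS : Prop :=
  ∀ φs : ℝ, 0 < φs →
  ∀ (a₀ θ₀ : T3 → ℝ) (u₀ : T3 → V3), Continuous a₀ → Continuous θ₀ → Continuous u₀ →
    (∀ x, 0 < a₀ x) → (∀ x, 0 < θ₀ x) →
  ∃ σ₀ : ℝ, 0 < σ₀ ∧ ∀ σ : ℝ, 0 < σ → σ < σ₀ → ∀ Φ : (N : ℕ) → Flow σ N, ∀ τ : ℝ, 0 < τ → ∀ δ : ℝ, 0 < δ →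
    (∃ T : ℝ, 0 < T ∧ ∀ m : ℕ, 1 ≤ m → ∃ c₀ : ℝ, 0 < c₀ ∧ ∀ c : ℝ, c₀ ≤ c → ∃ N₀ : ℕ, ∀ N : ℕ, N₀ ≤ N →
      ∫⁻ z, ENNReal.ofReal (unitAvgS c m σ N τ fun k q =>
          rowCountS c m σ N (Φ N) k q z * (if T < rowCountS c m σ N (Φ N) k q z then 1 else 0))
        ∂(localGibbsLaw σ a₀ u₀ θ₀ N (Φ N)) ≤ ENNReal.ofReal δ) ∧
    (∀ m : ℕ, 1 ≤ m → ∃ c₀ : ℝ, 0 < c₀ ∧ ∀ c : ℝ, c₀ ≤ c → ∃ N₀ : ℕ, ∀ N : ℕ, N₀ ≤ N →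
      ∫⁻ z, ENNReal.ofReal (unitAvgS c m σ N τ fun k q =>
          if (pop c σ N ((Φ N).flow (stepStartS m σ N k) z) q).Nonempty ∧
              Dense φs c σ N ((Φ N).flow (stepStartS m σ N k) z) q then 1 else 0)
        ∂(localGibbsLaw σ a₀ u₀ θ₀ N (Φ N)) ≤ ENNReal.ofReal δ)

/-- **`NoKineticIrregularityBS`** — OCCUPIED-OR-VOID-ADJACENT KINETIC CELLS ARE RARELY IRREGULAR UNDER THE EVOLVED LAW (the tree's
`NoKineticIrregularityB` sampled at the short-step starts `kΔ'`; item-class): actual cells with a populated `4cℓ`-neighbourhood that are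
`ϑ`-inhomogeneous (binned smoothed laws of cell vs neighbourhood; voids count) or hold fewer than `n₀` spheres are rare in `LG`-mean. -/
def NoKineticIrregularityBS : Prop :=
  ∀ (a₀ θ₀ : T3 → ℝ) (u₀ : T3 → V3), Continuous a₀ → Continuous θ₀ → Continuous u₀ →
    (∀ x, 0 < a₀ x) → (∀ x, 0 < θ₀ x) →
  ∃ σ₀ : ℝ, 0 < σ₀ ∧ ∀ σ : ℝ, 0 < σ → σ < σ₀ → ∀ Φ : (N : ℕ) → Flow σ N, ∀ τ : ℝ, 0 < τ →
  ∀ ϑs ϑ δ : ℝ, ∀ n₀ : ℕ, 0 < ϑs → 0 < ϑ → 0 < δ → ∀ m : ℕ, 1 ≤ m →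
    ∃ c₀ : ℝ, 0 < c₀ ∧ ∀ c : ℝ, c₀ ≤ c → ∃ b₀ : ℝ, 0 < b₀ ∧ ∀ b : ℝ, 0 < b → b ≤ b₀ → ∃ N₀ : ℕ, ∀ N : ℕ, N₀ ≤ N →
    ∫⁻ z, ENNReal.ofReal (unitAvgS c m σ N τ fun k q =>
        if (∃ x : T3, cellOf c σ N x = q) ∧ (nbhd c σ N ((Φ N).flow (stepStartS m σ N k) z) q).Nonempty ∧
            (ϑ < inhom ϑs (binConfig b ((Φ N).flow (stepStartS m σ N k) z))
                (pop c σ N ((Φ N).flow (stepStartS m σ N k) z) q)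
                (nbhd c σ N ((Φ N).flow (stepStartS m σ N k) z) q) ∨
              ((pop c σ N ((Φ N).flow (stepStartS m σ N k) z) q).Nonempty ∧
                (pop c σ N ((Φ N).flow (stepStartS m σ N k) z) q).card < n₀)) then 1 else 0)
      ∂(localGibbsLaw σ a₀ u₀ θ₀ N (Φ N)) ≤ ENNReal.ofReal δ

/-- **`RevealedDefectStabilityS`** — under the evolved law the truncated collision weight of units whose defect is not determined up to
`η` by the revealed data (grazing kicks below the bin width, fast participants, cold partners) is small (the tree's
`RevealedDefectStability` at step `ℓ_N/m`; item-class LG-side tail input, reducible as there to a `RoughCollisionRare`-type minimal input plus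
the deterministic `DefectOscDomination`). -/
def RevealedDefectStabilityS : Prop :=
  ∀ (a₀ θ₀ : T3 → ℝ) (u₀ : T3 → V3), Continuous a₀ → Continuous θ₀ → Continuous u₀ →
    (∀ x, 0 < a₀ x) → (∀ x, 0 < θ₀ x) →
  ∃ σ₀ : ℝ, 0 < σ₀ ∧ ∀ σ : ℝ, 0 < σ → σ < σ₀ → ∀ Φ : (N : ℕ) → Flow σ N, ∀ τ : ℝ, 0 < τ →
  ∀ Ψ : V3 × V3 × V3 → ℝ, Continuous Ψ → (∃ C : ℝ, ∀ p, |Ψ p| ≤ C) →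
  ∀ η δ T : ℝ, 0 < η → 0 < δ → 0 < T → ∀ m : ℕ, 1 ≤ m →
  ∃ c₀ : ℝ, 0 < c₀ ∧ ∀ c : ℝ, c₀ ≤ c → ∃ b₀ : ℝ, 0 < b₀ ∧ ∀ b : ℝ, 0 < b → b ≤ b₀ → ∃ N₀ : ℕ, ∀ N : ℕ, N₀ ≤ N →
    ∫⁻ z, ENNReal.ofReal (unitAvgS c m σ N τ fun k q =>
        min (ownedCountS c m σ N (Φ N) k q z) T *
          (if η < defectOscS Ψ b c m σ N (Φ N) k q z then 1 else 0))
      ∂(localGibbsLaw σ a₀ u₀ θ₀ N (Φ N)) ≤ ENNReal.ofReal δ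

/-- **`CoarseLocalMaxwellianityWS`** — COLLISION-WEIGHTED LOCAL EQUILIBRIUM OF THE EVOLVED LAW AT THE KINETIC-CELL SCALE, sampled at the
short-step starts (the tree's `CoarseLocalMaxwellianityW` at step `ℓ_N/m`): the `LG`-mean of the unit average of
`𝟙{occupied ∧ ϑ < relEnt (binned) at kΔ'} · min(ownedCountS (k,q), T)` is `≤ δ`. FILED DIRECTLY (lead c3 §4.3 / §7): an LG-side statement
of hydrodynamic-limit class (propagation of local Maxwellianity in the collision-weighted mean), which the saturated line derived from the
every-rate `MesoStaticMaxwellRarityW` — the detour this line drops. -/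
def CoarseLocalMaxwellianityWS : Prop :=
  ∀ (a₀ θ₀ : T3 → ℝ) (u₀ : T3 → V3), Continuous a₀ → Continuous θ₀ → Continuous u₀ →
    (∀ x, 0 < a₀ x) → (∀ x, 0 < θ₀ x) →
  ∃ σ₀ : ℝ, 0 < σ₀ ∧ ∀ σ : ℝ, 0 < σ → σ < σ₀ → ∀ Φ : (N : ℕ) → Flow σ N, ∀ τ : ℝ, 0 < τ →
  ∀ ϑs ϑ δ T : ℝ, 0 < ϑs → 0 < ϑ → 0 < δ → 0 < T → ∀ m : ℕ, 1 ≤ m →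
    ∃ c₀ : ℝ, 0 < c₀ ∧ ∀ c : ℝ, c₀ ≤ c → ∃ b₀ : ℝ, 0 < b₀ ∧ ∀ b : ℝ, 0 < b → b ≤ b₀ → ∃ N₀ : ℕ, ∀ N : ℕ, N₀ ≤ N →
    ∫⁻ z, ENNReal.ofReal (unitAvgS c m σ N τ fun k q =>
        (if (pop c σ N ((Φ N).flow (stepStartS m σ N k) z) q).Nonempty ∧
            ϑ < relEnt ϑs (binConfig b ((Φ N).flow (stepStartS m σ N k) z))
              (pop c σ N ((Φ N).flow (stepStartS m σ N k) z) q) then (1 : ℝ) else 0) *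
          min (ownedCountS c m σ N (Φ N) k q z) T)
      ∂(localGibbsLaw σ a₀ u₀ θ₀ N (Φ N)) ≤ ENNReal.ofReal δ

/-- **`NoMesoscopicOscillationRS`** — NO STRUCTURE OF THE EVOLVED ONE-BODY LAW BETWEEN THE KINETIC CELL AND THE `r`-BALL, typed against the
target's own `targetPm` and sampled at the short-step starts (the tree's `NoMesoscopicOscillationR` at step `ℓ_N/m`; the route's kill
criterion (iv), shared by every line on this crux): for every bounded continuous `Ξ` and `η, δ > 0` there is `r₀ > 0` such that for
`0 < r < r₀` and every `m ≥ 1` there is `c₀` with: for `c ≥ c₀` and all large `N`, with `LG`-probability `≥ 1 − δ` the unit average of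
`Σ_{q'} collPairS 1 (q,q') · |A_r(kΔ', centre q) · (pairPairS Ξ / pairPairS 1)(q,q') − B^Ξ_r(kΔ', centre q)|` is `≤ η`. -/
def NoMesoscopicOscillationRS : Prop :=
  ∀ (a₀ θ₀ : T3 → ℝ) (u₀ : T3 → V3), Continuous a₀ → Continuous θ₀ → Continuous u₀ →
    (∀ x, 0 < a₀ x) → (∀ x, 0 < θ₀ x) →
  ∃ σ₀ : ℝ, 0 < σ₀ ∧ ∀ σ : ℝ, 0 < σ → σ < σ₀ → ∀ Φ : (N : ℕ) → Flow σ N, ∀ τ : ℝ, 0 < τ →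
  ∀ Ξ : V3 × V3 × V3 → ℝ, Continuous Ξ → (∃ C : ℝ, ∀ p, |Ξ p| ≤ C) →
    ∀ η δ : ℝ, 0 < η → 0 < δ → ∃ r₀ : ℝ, 0 < r₀ ∧ ∀ r : ℝ, 0 < r → r < r₀ → ∀ m : ℕ, 1 ≤ m →
    ∃ c₀ : ℝ, 0 < c₀ ∧ ∀ c : ℝ, c₀ ≤ c → ∃ N₀ : ℕ, ∀ N : ℕ, N₀ ≤ N →
      localGibbsLaw σ a₀ u₀ θ₀ N (Φ N) {z | η < unitAvgS c m σ N τ fun k q => ∑' q' : Cell,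
        collPairS (fun _ => 1) c m σ N (Φ N) k q q' z *
          |targetPm (fun _ => 1) r τ σ N (Φ N) z (stepStartS m σ N k) (cellCentre c σ N q) *
              (pairPairS Ξ c m σ N (Φ N) k q q' z / pairPairS (fun _ => 1) c m σ N (Φ N) k q q' z) -
            targetPm Ξ r τ σ N (Φ N) z (stepStartS m σ N k) (cellCentre c σ N q)|} ≤ ENNReal.ofReal δ

/-! ## §5 The stubs -/

/-- **S1 (crux-class, THE open stub).** See `ConditionalForecastChaosS`. -/
theorem stub_conditionalForecastChaos : ConditionalForecastChaosS := by
  sorry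

/-- **S2 (item-class, LG-side a-priori).** See `NonGenericRareS`. -/
theorem stub_nonGenericRare : NonGenericRareS := by
  sorry

/-- **S3 (item-class, LG-side a-priori: the KINETIC CLAMP of the evolved law)** — short-step row-count uniform integrability + packing cap,
no kinetic voids / inhomogeneity / rarefaction, and stability of the revealed defect (grazing / fast / cold tails): the three tail-and-
regularity inputs the transfer and the docking consume, bundled (lead c5 §4: one kinetic-scale static clamp). -/
theorem stub_kineticClamp : LocalCountUIS ∧ NoKineticIrregularityBS ∧ RevealedDefectStabilityS := by
  sorry

/-- **S4 (item-class, LG-side, local-equilibrium class).** See `CoarseLocalMaxwellianityWS`. -/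
theorem stub_coarseLocalMaxwellianity : CoarseLocalMaxwellianityWS := by
  sorry

/-- **S5 (item-class; the route's kill criterion (iv) typed).** See `NoMesoscopicOscillationRS`. -/
theorem stub_noMesoscopicOscillation : NoMesoscopicOscillationRS := by
  sorry

/-- **S6 `stub_shortStepTransfer` — THE FORECAST TRANSFER AT THE SCALE PAIR `(cℓ_N, ℓ_N/m)`** (theorem-class, L: the re-landing of
`kineticCellChaosLG_of_w` / `stub_forecastTransferW`, p154660 / p157027, with the short-step vocabulary of §1–§2). Plan, hypothesis by
hypothesis of that architecture: H1 `ForecastSwap` ← `predictableProjection_holds` on the short-step sequential filtration (per-unit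
increments `≤ T h³`, budget `KL(LG‖G_N) ≤ A(N+1)` by `exists_lgTransferConst`'s entropy part, remainder `T h³ √(2·27·A(N+1)/K) → 0` with
`K = numStepsS → ∞` FASTER than at long steps); H2' (binned-good ∧ generic ∧ forecast-bad is `LG`-NULL) ← S1 + `LG ≪ G_N` — NO entropy
inequality; H3' (weighted mass of occupied units that are non-good OR non-generic is small) ← `CoarseLocalMaxwellianityWS` + `T ×` the
fractions of `LocalCountUIS` (ii) / `NoKineticIrregularityBS` + `NonGenericRareS`; H4 `RevealedSandwich` ← `RevealedDefectStabilityS` + the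
deterministic dictionary (owned count revealed, `|unitDefectS z' − unitDefectS z| ≤ defectOscS z` on atoms; `stub_atomCollisionDictionary`'s
enumeration is step-length agnostic); H5/H5_W (`ForecastAlgebra`, `ForecastSplitW` with the revealed indicator `J' := Jng ∨ ¬GenericO`) ←
conditional-expectation bookkeeping under `G_N` transported to `LG`. -/
theorem stub_shortStepTransfer :
    ConditionalForecastChaosS → NonGenericRareS → LocalCountUIS → NoKineticIrregularityBS → CoarseLocalMaxwellianityWS →
      RevealedDefectStabilityS → KineticCellChaosLGS := by
  sorry

/-- **S7 `stub_shortStepDocking` — DOCKING INTO THE TARGET AT STEP `ℓ_N/m`** (theorem-class, L: the re-landing of `stub_dockingR`, p143824,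
pieces p126653–p136041, with `collPairS`/`pairPairS`/`unitAvgS`): tile the target's collision sum by (short step, start cell) units, replace
each unit's collision average of `Ψ·A_r` by `A_r ·` (flux-product own-pair-law average) up to `η·ownedCountS` on good-defect units
(`KineticCellChaosLGS`) and `T`-tails (`LocalCountUIS` (i)), move `A_r, B^Ψ_r` from the collision point/time to the unit's
`(kΔ', centre q)` by the Lipschitz moduli of `bt` (`r⁻²`) and `bx` (`3/(πr⁴)`) against displacement `≤ cℓ_N + Δ'·speed` — budget
`(Δ' + h)/r⁴ → 0` as `N → ∞` at fixed `(m, c)` — and close with `NoMesoscopicOscillationRS`; quantifier bookkeeping: `m` is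
`KineticCellChaosLGS`'s witness (the LG-side inputs hold for every `m ≥ 1`), `T` from `LocalCountUIS` (i), then `c ≥` the four `c₀`'s, then `N₀`. -/
theorem stub_shortStepDocking :
    KineticCellChaosLGS → NoMesoscopicOscillationRS → LocalCountUIS →
      Summit.AtomisticToContinuum.HydrodynamicLimit.Theses.InformationPercolationEngine.ContactChaos := by
  sorry

/-! ## §6 Composition (sorry-free) -/

/-- **Composition, explicit form.** The seven stub STATEMENTS imply the crux `InformationPercolationEngine.PercolationClosesChaos`,
concluded BY NAME. The crux's two hypotheses are not used (Disproof §1 `crux_of_contactChaos`, F16). -/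
theorem PercolationClosesChaos_of_stubs :
    ConditionalForecastChaosS → NonGenericRareS →
    (LocalCountUIS ∧ NoKineticIrregularityBS ∧ RevealedDefectStabilityS) →
    CoarseLocalMaxwellianityWS → NoMesoscopicOscillationRS →
    (ConditionalForecastChaosS → NonGenericRareS → LocalCountUIS → NoKineticIrregularityBS → CoarseLocalMaxwellianityWS →
      RevealedDefectStabilityS → KineticCellChaosLGS) →
    (KineticCellChaosLGS → NoMesoscopicOscillationRS → LocalCountUIS →
      Summit.AtomisticToContinuum.HydrodynamicLimit.Theses.InformationPercolationEngine.ContactChaos) →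
    Summit.AtomisticToContinuum.HydrodynamicLimit.Theses.InformationPercolationEngine.PercolationClosesChaos :=
  fun h1 h2 h3 h4 h5 h6 h7 _ _ => h7 (h6 h1 h2 h3.1 h3.2.1 h4 h3.2.2) h5 h3.1

/-- The line reaches the route TARGET. -/
theorem contactChaos_of_stubs :
    Summit.AtomisticToContinuum.HydrodynamicLimit.Theses.InformationPercolationEngine.ContactChaos :=
  stub_shortStepDocking
    (stub_shortStepTransfer stub_conditionalForecastChaos stub_nonGenericRare stub_kineticClamp.1 stub_kineticClamp.2.1
      stub_coarseLocalMaxwellianity stub_kineticClamp.2.2)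
    stub_noMesoscopicOscillation stub_kineticClamp.1

/-- **Composition.** The stubs imply the crux, concluded BY NAME (kernel-checked; the only `sorry`s are inside the stubs it invokes). -/
theorem PercolationClosesChaos_of :
    Summit.AtomisticToContinuum.HydrodynamicLimit.Theses.InformationPercolationEngine.PercolationClosesChaos :=
  PercolationClosesChaos_of_stubs stub_conditionalForecastChaos stub_nonGenericRare stub_kineticClamp
    stub_coarseLocalMaxwellianity stub_noMesoscopicOscillation stub_shortStepTransfer stub_shortStepDocking

end Summit.AtomisticToContinuum.HydrodynamicLimit.Cruxes.PercolationClosesChaos.ShortStepConditionalForecast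

end
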